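import Mathlib
import HarnessLib.Audit
import Summits.PneNP.PneNP.Theorems.PstarGateCasePUnitsEq
import Summits.PneNP.PneNP.Theorems.PstarGateCasePUnitsUnit
import Summits.PneNP.PneNP.Theorems.PstarGateCasePUnitsMixed
import Summits.PneNP.PneNP.Theorems.PstarGateCountOfUnits

/-!
# One GATED chord, node N2X CLOSED — and with it the E2 count `GateCountX` and `TerminalFiveCotree1Blind` (prover-1 g21)

FRONTIER range-avoidance ladder, rung F-N3 (`stmt-PneNP-19007`), cell `pnp-ideate` (`PstarGateNodesX`); restricted-model proof complexity — nothing
here bears on `P` versus `NP`.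

The last of the seven closed-core one-gate nodes.  CASE P (`ReadAlong (1,0)`), at least one other chord, none (NOR): by
`PstarGateCasePRegimes.caseP_regimes` the chords other than `e` number at most two, each (EQ) or an EXC-unit, at most one of each kind.  Two of
them (one unit, one (EQ)) cannot coexist (`PstarGateCasePUnitsMixed.unit_eq_false`, the unit being ON on `Z(q)` by `caseP_forced`); a single
(EQ) chord gives `#J₀ ≤ 5` by `PstarGateCasePUnitsEq.caseP_eq_card_le`, a single EXC-unit by `PstarGateCasePUnitsUnit.caseP_unit_card_le`.

* `gateCasePUnitsX_holds : GateCasePUnitsX` — **node N2 (v2) HOLDS**;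
* `gateCountX_holds : GateCountX` — **every one-gate bridge datum on an XOR-closed core has at most five outputs** (`gateCountX_of_units`);
* `terminalFiveCotree1Blind_holds : TerminalFiveCotree1Blind` — **the blind free cotree-partner gate (E2) of the O2 residue is settled**
  (`cotree1Blind_of_units`).
With this file the E2 chain `TerminalFiveCotree1Blind ⟸ GateCountX ⟸ N1X ∧ … ∧ N6′X` of `PstarGateNodesX` is complete: all seven nodes are theorems.
-/

set_option linter.dupNamespace false -- `Summit.PneNP.PneNP.…`: summit = sub-problem name (D-0017 single-conjunct layout)

open Finset Literature.Computability.Complexity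
open Summit.PneNP.PneNP.Theorems.PstarReadSumset (V2)
open Summit.PneNP.PneNP.Theorems.PstarChordSystem (ChordSystem)
open Summit.PneNP.PneNP.Theorems.PstarChordBridge (BridgeData sys Solution)
open Summit.PneNP.PneNP.Theorems.PstarChordBridgeForcing (gam)
open Summit.PneNP.PneNP.Theorems.PstarCoupled (TerminalFiveCotree1Blind)
open Summit.PneNP.PneNP.Theorems.PstarGateBridge (GateHyp caseP_forced)
open Summit.PneNP.PneNP.Theorems.PstarGateCasePRegimes (NorCert EqCert UnitCert caseP_regimes)
open Summit.PneNP.PneNP.Theorems.PstarGateNodes (GateData ReadAlong AllRead)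
open Summit.PneNP.PneNP.Theorems.PstarGateNodesX (GateDataX GateCasePUnitsX GateCountX)
open Summit.PneNP.PneNP.Theorems.PstarGateCasePUnitsMixed (unit_eq_false)
open Summit.PneNP.PneNP.Theorems.PstarGateCasePUnitsEq (caseP_eq_card_le)
open Summit.PneNP.PneNP.Theorems.PstarGateCasePUnitsUnit (caseP_unit_card_le)
open Summit.PneNP.PneNP.Theorems.PstarGateCountOfUnits (gateCountX_of_units cotree1Blind_of_units)

namespace Summit.PneNP.PneNP.Theorems.PstarGateCasePUnitsFinal

/-- **Node N2 (v2) `GateCasePUnitsX` HOLDS.** -/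
theorem gateCasePUnitsX_holds : GateCasePUnitsX := by
  intro n m r I hI hT hS hB B e g₀ u κ₀ hD hRA hread hne hnoNOR
  classical
  obtain ⟨-, hW, hr, hd₁, hd₂, hL, -, -, hG, hg₀, hgv, -, hup, hux, hG₁p, -, hT3, hM0⟩ := id hD
  have hM0N : ∀ f ∈ B.N, ∃ z, Solution I B (B.J₀.erase f) z := fun f hf => hM0 f (hW.hN hf)
  have hP : ∀ e' ∈ B.N, e' ≠ e → ∀ a, ((sys I B).ρ e' a).2 = 0 ∧ ((sys I B).ρ' e' a).2 = 0 := by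
    intro e' he' hne' a
    obtain ⟨h1, h2⟩ := hRA e' he' hne' a
    refine ⟨?_, ?_⟩
    · rcases h1 with h | h
      · rw [h]; rfl
      · rw [h]
    · rcases h2 with h | h
      · rw [h]; rfl
      · rw [h]
  rcases caseP_regimes I hI hT hS hB hW hr hd₁ hd₂ hL hG hg₀ hgv hup hux hG₁p hT3 hM0N hP with hNOR | ⟨hEU, hEQ1, hU1, hcard⟩
  · -- every other chord (NOR): excluded
    obtain ⟨e', he'⟩ := hne
    obtain ⟨hne', he'N⟩ := mem_erase.1 he'
    exact absurd (hNOR e' he'N hne') (hnoNOR e' he'N hne')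
  · rcases Nat.lt_or_ge (B.N.erase e).card 2 with hlt | hge
    · -- exactly one other chord
      have h1 : (B.N.erase e).card = 1 := by
        have hpos : 0 < (B.N.erase e).card := card_pos.2 hne
        omega
      obtain ⟨e', hNe⟩ := card_eq_one.1 h1
      have he' : e' ∈ B.N.erase e := by rw [hNe]; exact mem_singleton_self _
      obtain ⟨hne', he'N⟩ := mem_erase.1 he'
      rcases hEU e' he'N hne' with hE | hUn
      · exact caseP_eq_card_le I hI hT hS hB hD hRA hread hNe hE
      · exact caseP_unit_card_le I hI hT hS hB hD hRA hread hNe hUn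
    · -- two other chords: one (EQ), one unit — impossible
      exfalso
      obtain ⟨e₁, he₁, e₂, he₂, h12⟩ := one_lt_card.1 (by omega : 1 < (B.N.erase e).card)
      obtain ⟨hne₁, he₁N⟩ := mem_erase.1 he₁
      obtain ⟨hne₂, he₂N⟩ := mem_erase.1 he₂
      have hP1 : ∀ {f : Fin m}, f ∈ B.N → f ≠ e → ∀ x, PstarChordBridgeBasis.qDir I B (1, 0) x = 0 →
          PstarProductRank.qform (B.D f) (fun j => I.vars j 2) (fun j => I.vars j 3) x = gam B f + 1 :=
        fun hf hfe x hx => (caseP_forced I hI hT hW hL hG hT3 hRA hread hx).1 _ hf hfe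
      rcases hEU e₁ he₁N hne₁ with hE₁ | hU₁ <;> rcases hEU e₂ he₂N hne₂ with hE₂ | hU₂
      · exact h12 (hEQ1 e₁ he₁N hne₁ e₂ he₂N hne₂ hE₁ hE₂)
      · exact unit_eq_false I hI hS hW he₂N he₁N (Ne.symm h12) hU₂ hE₁ (hP1 he₂N hne₂)
      · exact unit_eq_false I hI hS hW he₁N he₂N h12 hU₁ hE₂ (hP1 he₁N hne₁)
      · exact h12 (hU1 e₁ he₁N hne₁ e₂ he₂N hne₂ hU₁ hU₂)

/-- **The E2 count: every one-gate bridge datum on an XOR-closed core has at most five outputs.** -/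
theorem gateCountX_holds : GateCountX := gateCountX_of_units gateCasePUnitsX_holds

/-- **`TerminalFiveCotree1Blind` HOLDS** — the blind free cotree-partner gate (E2) of the O2 residue. -/
theorem terminalFiveCotree1Blind_holds : TerminalFiveCotree1Blind := cotree1Blind_of_units gateCasePUnitsX_holds

end Summit.PneNP.PneNP.Theorems.PstarGateCasePUnitsFinal
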